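import Literature.RingTheory.MvPowerSeries.HasseDerivFrobenius
import HarnessLib

/-!
# Divided (Hasse) derivatives of unit-monomials `u · X^θ` with `u` a `p^N`-th power

Topic: `Literature/RingTheory/MvPowerSeries`. For the divided partial derivatives
`Δ_α = hasseDeriv α` of `A⟦X_τ⟧` (`AdicTaylor.lean`) over a commutative ring `A` of prime
characteristic `p`, finitely many variables `τ`, and a multi-order `α` with EVERY COORDINATE
`α_s < p^N`:

* `hasseDeriv_mul_monomial_of_isSupportedOnMultiples` — if `u ∈ A⟦X^{p^N}⟧`
  (`IsSupportedOnMultiples (p^N) u`, e.g. `u = f^{p^N}`), then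
  `Δ_α (u · c X^θ) = u · C(θ, α) c X^{θ−α}` when `α ≤ θ` (coordinatewise) and `= 0` otherwise;
  `hasseDeriv_pow_mul_monomial` is the case `u = f^{p^N}`; `hasseDeriv_mul_prod_X_pow_of_isSupportedOnMultiples`
  / `hasseDeriv_pow_mul_prod_X_pow` are the same with the monomial written `∏_s X_s^{θ_s}` (the
  private `prod_X_pow_eq_monomial` converts).
* `hasseDeriv_mul_monomial_eq_zero_of_not_le`, `hasseDeriv_pow_mul_monomial_eq_zero_of_not_le`,
  `hasseDeriv_mul_prod_X_pow_eq_zero_of_not_le` — the ANNIHILATION criterion: `Δ_α` kills every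
  unit-monomial `u X^θ` (unit factor supported on `p^N ℕ^τ`) whose monomial `X^θ` is not divisible
  by `X^α`, i.e. `¬ α ≤ θ`.
* `hasseDeriv_mul_monomial_of_le`, `hasseDeriv_pow_mul_monomial_of_le` — the value in the divisible
  case `α ≤ θ`.

These are two-line consequences of `hasseDeriv_mul_of_isSupportedOnMultiples` (linearity of
`Δ_α` over `A⟦X^{p^N}⟧`, [Abad2019pBases] Lemma 6.2, file `HasseDerivFrobenius.lean`) and
`hasseDeriv_monomial` (`Δ_α X^θ = C(θ,α) X^{θ−α}`), packaged in the shape in which finite sums of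
unit-monomials `Σ u_θ X^θ` with `u_θ ∈ A⟦X⟧^{p^N}` are differentiated term by term.

## Source (read on the page) and what is proved here

C. Abad, *p-bases and differential operators on varieties defined over a non-perfect field*,
J. Algebra 523 (2019) = arXiv:1801.08458 [Abad2019pBases], §6 p. 13 (held text p0013): Lemma 6.2
(Giraud) «If Δ : A → M is a differential operator of order n over k, then Δ is k[A^{p^e}]-linear for
every p^e > n» and «Tay^β(X^α) = binom(α, β) X^{α−β}» with «binom(α_λ, β_λ) = 0 whenever
α_λ < β_λ». WHAT THIS FILE PROVES: the combination of the two for the power-series operators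
`hasseDeriv` of the tree — the values of `Δ_α` on `u · c X^θ` with `u` supported on `p^N ℕ^τ` — by
rewriting with the two library theorems; no new mathematics. NOT here: anything about sums of such
terms beyond linearity (`map_sum`), any order estimate.
-/

noncomputable section

open _root_.MvPowerSeries

namespace Literature.RingTheory.MvPowerSeries

universe u v

variable {τ : Type v} {A : Type u} [CommRing A]

/-! ## Products of powers of the variables -/

/-- A finite product of monic monomials is the monic monomial of the sum of the exponents. [folklore] -/
private theorem prod_monomial_one' {ι : Type*} (s : Finset ι) (d : ι → τ →₀ ℕ) :
    ∏ i ∈ s, (monomial (d i) (1 : A) : MvPowerSeries τ A) = monomial (∑ i ∈ s, d i) 1 := by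
  classical
  induction s using Finset.induction_on with
  | empty => rfl
  | insert i s hi ih =>
    rw [Finset.prod_insert hi, Finset.sum_insert hi, ih, monomial_mul_monomial, one_mul]

/-- `∏_s X_s^{θ_s} = X^θ` in `A⟦X_τ⟧` (`τ` finite): the product of powers of the variables is the monic
monomial `monomial θ 1` — plumbing between the sources' product notation `X^θ = ∏_s X_s^{θ_s}` and
Mathlib's `MvPowerSeries.monomial` (private; the public statements below come in both shapes). [folklore] -/
private theorem prod_X_pow_eq_monomial [Fintype τ] (θ : τ →₀ ℕ) :
    ∏ s, (X s : MvPowerSeries τ A) ^ θ s = monomial θ 1 := by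
  classical
  simp_rw [X_pow_eq]
  rw [prod_monomial_one', Finsupp.univ_sum_single]

/-! ## Divided derivatives of `u · c X^θ`, `u` supported on `p^N ℕ^τ` (prime characteristic `p`) -/

section Frobenius

variable (p : ℕ) [hp : Fact p.Prime] [CharP A p] [Fintype τ] [DecidableEq τ]

/-- **`Δ_α (u · c X^θ)`** for `u ∈ A⟦X^{p^N}⟧` and `α_s < p^N` for all `s`: equal to
`u · C(θ, α) c X^{θ−α}` if `α ≤ θ` and to `0` otherwise (`Δ_α` is `A⟦X^{p^N}⟧`-linear and
`Δ_α X^θ = C(θ,α) X^{θ−α}`). [cite: Abad2019pBases, Lemma 6.2] -/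
theorem hasseDeriv_mul_monomial_of_isSupportedOnMultiples {N : ℕ} {α : τ →₀ ℕ}
    (hα : ∀ s, α s < p ^ N) {u : MvPowerSeries τ A} (hu : IsSupportedOnMultiples (p ^ N) u)
    (θ : τ →₀ ℕ) (c : A) :
    hasseDeriv α (u * monomial θ c) =
      if α ≤ θ then u * monomial (θ - α) (((θ.prod fun s n => n.choose (α s) : ℕ) : A) * c)
      else 0 := by
  rw [hasseDeriv_mul_of_isSupportedOnMultiples p hα hu, hasseDeriv_monomial]
  split_ifs
  · rfl
  · rw [mul_zero]

/-- **`Δ_α (f^{p^N} · c X^θ)`** for `α_s < p^N`: `f^{p^N} · C(θ, α) c X^{θ−α}` if `α ≤ θ`, else `0`.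
[cite: Abad2019pBases, Lemma 6.2] -/
theorem hasseDeriv_pow_mul_monomial {N : ℕ} {α : τ →₀ ℕ} (hα : ∀ s, α s < p ^ N)
    (f : MvPowerSeries τ A) (θ : τ →₀ ℕ) (c : A) :
    hasseDeriv α (f ^ p ^ N * monomial θ c) =
      if α ≤ θ then f ^ p ^ N * monomial (θ - α) (((θ.prod fun s n => n.choose (α s) : ℕ) : A) * c)
      else 0 :=
  hasseDeriv_mul_monomial_of_isSupportedOnMultiples p hα (isSupportedOnMultiples_pow p f N) θ c

/-- **`Δ_α (u · ∏_s X_s^{θ_s})`** — product-of-powers form (the sources' `X^θ` is `∏_s X_s^{θ_s}`,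
Mathlib's `monomial θ 1`): for `u ∈ A⟦X^{p^N}⟧` and `α_s < p^N` for all `s`,
`Δ_α (u · X^θ) = u · C(θ, α) X^{θ−α}` if `α ≤ θ`, else `0`. [cite: Abad2019pBases, Lemma 6.2] -/
theorem hasseDeriv_mul_prod_X_pow_of_isSupportedOnMultiples {N : ℕ} {α : τ →₀ ℕ}
    (hα : ∀ s, α s < p ^ N) {u : MvPowerSeries τ A} (hu : IsSupportedOnMultiples (p ^ N) u)
    (θ : τ →₀ ℕ) :
    hasseDeriv α (u * ∏ s, (X s : MvPowerSeries τ A) ^ θ s) =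
      if α ≤ θ then u * monomial (θ - α) (((θ.prod fun s n => n.choose (α s) : ℕ) : A))
      else 0 := by
  rw [prod_X_pow_eq_monomial, hasseDeriv_mul_monomial_of_isSupportedOnMultiples p hα hu, mul_one]

/-- **`Δ_α (f^{p^N} · ∏_s X_s^{θ_s})`** — product-of-powers form, `p^N`-th power unit factor.
[cite: Abad2019pBases, Lemma 6.2] -/
theorem hasseDeriv_pow_mul_prod_X_pow {N : ℕ} {α : τ →₀ ℕ} (hα : ∀ s, α s < p ^ N)
    (f : MvPowerSeries τ A) (θ : τ →₀ ℕ) :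
    hasseDeriv α (f ^ p ^ N * ∏ s, (X s : MvPowerSeries τ A) ^ θ s) =
      if α ≤ θ then f ^ p ^ N * monomial (θ - α) (((θ.prod fun s n => n.choose (α s) : ℕ) : A))
      else 0 :=
  hasseDeriv_mul_prod_X_pow_of_isSupportedOnMultiples p hα (isSupportedOnMultiples_pow p f N) θ

/-- **Annihilation**: for `u ∈ A⟦X^{p^N}⟧`, `α_s < p^N` for all `s`, and `X^θ` NOT divisible by `X^α`
(`¬ α ≤ θ`), `Δ_α (u · c X^θ) = 0`. [cite: Abad2019pBases, Lemma 6.2] -/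
theorem hasseDeriv_mul_monomial_eq_zero_of_not_le {N : ℕ} {α : τ →₀ ℕ} (hα : ∀ s, α s < p ^ N)
    {u : MvPowerSeries τ A} (hu : IsSupportedOnMultiples (p ^ N) u) {θ : τ →₀ ℕ} (hθ : ¬ α ≤ θ)
    (c : A) : hasseDeriv α (u * monomial θ c) = 0 := by
  rw [hasseDeriv_mul_monomial_of_isSupportedOnMultiples p hα hu, if_neg hθ]

/-- **Annihilation**, `p^N`-th power form: `Δ_α (f^{p^N} · c X^θ) = 0` when `α_s < p^N` for all `s`
and `¬ α ≤ θ`. [cite: Abad2019pBases, Lemma 6.2] -/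
theorem hasseDeriv_pow_mul_monomial_eq_zero_of_not_le {N : ℕ} {α : τ →₀ ℕ}
    (hα : ∀ s, α s < p ^ N) (f : MvPowerSeries τ A) {θ : τ →₀ ℕ} (hθ : ¬ α ≤ θ) (c : A) :
    hasseDeriv α (f ^ p ^ N * monomial θ c) = 0 :=
  hasseDeriv_mul_monomial_eq_zero_of_not_le p hα (isSupportedOnMultiples_pow p f N) hθ c

/-- **Annihilation**, product-of-powers form: `Δ_α (u · ∏_s X_s^{θ_s}) = 0` for `u ∈ A⟦X^{p^N}⟧`,
`α_s < p^N` for all `s`, and `¬ α ≤ θ`. [cite: Abad2019pBases, Lemma 6.2] -/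
theorem hasseDeriv_mul_prod_X_pow_eq_zero_of_not_le {N : ℕ} {α : τ →₀ ℕ} (hα : ∀ s, α s < p ^ N)
    {u : MvPowerSeries τ A} (hu : IsSupportedOnMultiples (p ^ N) u) {θ : τ →₀ ℕ} (hθ : ¬ α ≤ θ) :
    hasseDeriv α (u * ∏ s, (X s : MvPowerSeries τ A) ^ θ s) = 0 := by
  rw [prod_X_pow_eq_monomial]
  exact hasseDeriv_mul_monomial_eq_zero_of_not_le p hα hu hθ 1

/-- **Divisible case**: for `u ∈ A⟦X^{p^N}⟧`, `α_s < p^N` for all `s`, and `α ≤ θ`,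
`Δ_α (u · c X^θ) = u · C(θ, α) c X^{θ−α}`. [cite: Abad2019pBases, Lemma 6.2] -/
theorem hasseDeriv_mul_monomial_of_le {N : ℕ} {α : τ →₀ ℕ} (hα : ∀ s, α s < p ^ N)
    {u : MvPowerSeries τ A} (hu : IsSupportedOnMultiples (p ^ N) u) {θ : τ →₀ ℕ} (hθ : α ≤ θ)
    (c : A) :
    hasseDeriv α (u * monomial θ c) =
      u * monomial (θ - α) (((θ.prod fun s n => n.choose (α s) : ℕ) : A) * c) := by
  rw [hasseDeriv_mul_monomial_of_isSupportedOnMultiples p hα hu, if_pos hθ]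

/-- **Divisible case**, `p^N`-th power form: `Δ_α (f^{p^N} · c X^θ) = f^{p^N} · C(θ, α) c X^{θ−α}`
for `α_s < p^N` and `α ≤ θ`. [cite: Abad2019pBases, Lemma 6.2] -/
theorem hasseDeriv_pow_mul_monomial_of_le {N : ℕ} {α : τ →₀ ℕ} (hα : ∀ s, α s < p ^ N)
    (f : MvPowerSeries τ A) {θ : τ →₀ ℕ} (hθ : α ≤ θ) (c : A) :
    hasseDeriv α (f ^ p ^ N * monomial θ c) =
      f ^ p ^ N * monomial (θ - α) (((θ.prod fun s n => n.choose (α s) : ℕ) : A) * c) :=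
  hasseDeriv_mul_monomial_of_le p hα (isSupportedOnMultiples_pow p f N) hθ c

/-- **Term-by-term differentiation of a finite unit-monomial sum**: for a finite family of exponents
`θ_i` and coefficients `u_i ∈ A⟦X^{p^N}⟧`, and `α_s < p^N` for all `s`,
`Δ_α (Σ_i u_i X^{θ_i}) = Σ_{i : α ≤ θ_i} u_i · C(θ_i, α) X^{θ_i − α}` — the terms not divisible by
`X^α` drop out. [cite: Abad2019pBases, Lemma 6.2] -/
theorem hasseDeriv_sum_mul_monomial {N : ℕ} {α : τ →₀ ℕ} (hα : ∀ s, α s < p ^ N) {ι : Type*}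
    (s : Finset ι) (u : ι → MvPowerSeries τ A) (hu : ∀ i ∈ s, IsSupportedOnMultiples (p ^ N) (u i))
    (θ : ι → τ →₀ ℕ) :
    hasseDeriv α (∑ i ∈ s, u i * monomial (θ i) 1) =
      ∑ i ∈ s.filter (fun i => α ≤ θ i),
        u i * monomial (θ i - α) (((θ i).prod fun t n => n.choose (α t) : ℕ) : A) := by
  rw [map_sum, Finset.sum_filter]
  refine Finset.sum_congr rfl fun i hi => ?_
  rw [hasseDeriv_mul_monomial_of_isSupportedOnMultiples p hα (hu i hi), mul_one]

end Frobenius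

end Literature.RingTheory.MvPowerSeries

end
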